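import Literature.NumberTheory.EllipticCurves.Kobayashi2003.SignedSelmerEtaComponentFacts
import HarnessLib

/-!
# Kobayashi 2003, Thm. 4.1 FIRST display at the quadratic character `η = ω^{(p−1)/2}`:
# `Char(X⁺(E/K_∞)^η) ⊇ (pⁿ L_p⁺(E, η, X))`, `n = 0` for `ρ_{E,p^∞}` onto — ONE named fact

Topic `Literature/NumberTheory/EllipticCurves`, cluster `Kobayashi2003` (namespace = path). Sibling of
`SignedSelmerEtaComponentFacts.lean` (cell `bsd-cm`, seat `bsd-cm-k8i-ty`: Thm. 2.2 at `η`
`thm22_etaSignedSelmerDual_finite_torsion`, Thm. 4.1 THIRD display (sign `−`)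
`thm41_minusEtaCharIdeal_dvd`, Thm. 7.4 at `η` `thm74_etaEvenMC_iff_etaOddMC`, and the branch-function
predicates `IsQuadraticBranchPlusLFunction` / `IsQuadraticBranchMinusLFunction`) and of
`SignedKatoDivisibility.lean` (the `η = 1` components, `thm41_signedCharIdeal_divisibility`). THIS FILE
adds the one display the sibling leaves out: Thm. 4.1, FIRST display (sign `+`) at the non-trivial
quadratic character — the Kato-side inclusion of the EVEN main conjecture at `η`. ONE named fact
(`def … : Prop`, nothing asserted, no `_holds`; net debt +1). Consumer: cell `bsd-potss`, rung K8,
route `QuadraticBranchSignedControl`, item stmt-BirchSwinnertonDyer-19241 `PlusKatoDivisibilityBranch`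
(the Kato half of the seam re-cut of (C1_η); `Theorems/QuadraticBranchSignedControlPlusKatoDivisibilityOfEta.lean`
takes exactly this text as its displayed hypothesis `hKη`). HONEST FRAMING (cells bsd-potss / bsd-cm):
BSD is not proved by any of this; a printed THEOREM is vendored as a named fact and nothing else;
no conjecture is vendored.

## Source, verbatim (S. Kobayashi, *Iwasawa theory for elliptic curves at supersingular primes*,
## Invent. Math. 152 (2003) 1–36 [Kobayashi2003]; held copy `paper:doi-10-1007-s00222-002-0265-4`,
## page = file number; re-read by this seat 2026-08-26, p0008)

Standing (p. 4): "Let `p` be an odd prime number. … Let `E` be an elliptic curve over `ℚ` with good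
reduction at `p`. We assume that `a_p = 0`." p. 8 (§4): "Let `η : Δ → ℤ_p^×` be a character. For a
`ℤ_p[Δ]`-module `M`, let `M^η` denote the `η`-component of `M`. … By Theorem 2.2, `X^±(E/K_∞)^η` is
a torsion `ℤ_p[[Γ]]`-module. **Conjecture (Even main conjecture).** For every `η`, we have
`Char(X⁺(E/K_∞)^η) = (L_p⁺(E, η, X))`. … **Theorem 4.1.** There exists an integer `n ≥ 0` such that
`Char(X⁺(E/K_∞)^η) ⊇ (pⁿ L_p⁺(E, η, X))`, `Char(X⁻(E/K_∞)^Δ) ⊇ (pⁿ L_p⁻(E, X))`,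
`Char(X⁻(E/K_∞)^η) ⊇ ((pⁿ/X) L_p⁻(E, η, X))` for `η ≠ 1`. If the `p`-adic representation
`Gal(ℚ̄/ℚ) → GL_{ℤ_p}(T)` is surjective, then we can take `n = 0`. Here `T = T_pE` is the `p`-adic
Tate module of `E`. *Proof.* This theorem is proved in Sect. 7." (From Kato's Thm. 12.5 = Thm. 5.2
there, through the even Coleman map; the `η`-sequence
`0 → H¹(T)^η/Z(T)^η → Λ^η/(L_p⁺(E, η, X)) → X⁺(E/K_∞)^η → X⁰(E/K_∞)^η → 0` of the proof of Thm. 7.4,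
p. 13.) p. 7, (3.4)/(3.6): the interpolation property of `L_p⁺(E, η, X)` (EVEN conductor exponents)
and its value at `X = 0`, `L_p⁺(E, η, 0) = −(p/τ(η)) L(E, η̄, 1)/Ω_E^δ` for `η ≠ 1`.

## Transcription and reading flags (identical to the sibling's, for the referee)

* OBJECT: `X⁺(E/K_∞)^η` = any `D : EtaSignedSelmerDualData V κ K₀ ℚ_[p] η γ 1` (file
  `CyclotomicTowerSignedSelmer.lean`; `K₀ = ℚ(μ_p)` via `IsCyclotomicExtension {p} ℚ K₀`, `κ` the
  cyclotomic `ℤ_p`-extension of `ℚ`, `K₀·ℚ_∞ = K_∞ = ℚ(μ_{p^∞})`, ONE place above `p`, sign `ε = 1` =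
  Kobayashi's `+`/even: Def. 2.1's plus condition at every layer). For `η² = 1` the dual of the
  `η`-eigen-subgroup IS `ε_η X` (`p ∤ #Δ`). No flag.
* WHICH `η`: `η : Γ_ℚ →* ℤˣ` trivial on `galRange K₀` and `η ≠ 1` = THE quadratic character
  `ω^{(p−1)/2}` of `Δ` (cyclic): the first display is printed "for every `η`", so in particular at
  this one. TODO(general form): `η : Δ → ℤ_p^×` of any order dividing `p − 1` (needs
  `ℤ_p[η]`-coefficients; not in the tree), as in the sibling.
* `L_p⁺(E, η, X)` = ANY `Lη ∈ Λ = ℤ_p⟦X⟧` with the interpolation property (3.4) + (3.6)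
  (`IsQuadraticBranchPlusLFunction f p ϖ Lη` of the sibling: Birch's formula, newform `f` of `E`,
  period ratio `ϖ` of the parity `δ = η(−1)`), UP TO A UNIT `u ∈ ℤ_p^×` (flag `Kob03-Lpm-eta-upto-unit`,
  as in the sibling: Néron `Ω_E^δ` versus the tree's `|Ω⁻|`, a sign, a power of `2`); unique up to
  `ℤ_p^×`, EXISTS by Thm. 3.2 (not asserted); the fact quantifies over all such `Lη`, and "`⊇ (g)`"
  is about the IDEAL, spelled `g ∈ Char` (`D.charIdeal = Module.charIdeal Λ D.X`), which does not see
  the unit. The variable: `IsCyclotomicVariable p γ` ("we identify `γ` with `1 + X`", §3 p. 5).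
* BOTH printed clauses: `∃ n, pⁿ·Lη ∈ Char(D.X)`; and `Lη ∈ Char(D.X)` if `ρ_{E,p^∞}` is onto,
  "surjective onto `GL_{ℤ_p}(T_pE)`" = `∀ m, V.HasSurjectiveModNGaloisRep (p^m)` (as in
  `kato_divisibility` (3), `thm41_signedCharIdeal_divisibility`, `thm41_minusEtaCharIdeal_dvd`). The
  torsion / finite generation of `D.X` are DISPLAYED as hypotheses exactly as the two siblings display
  them (they are `thm22_etaSignedSelmerDual_finite_torsion`). No flag.

What is NOT here: the even main conjecture at `η` itself (a CONJECTURE — for no curve, CM or not, is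
its `η ≠ 1` component a theorem in print: Pollack–Rubin 2004 p. 448 is a remark, Lei 2011 §7 does
`θ = 1` only; see the sibling's "What is NOT here"), the converse inclusion, Kato's formulation at `η`,
any proof.

References: [Kobayashi2003] Thm. 4.1 and §4 (p. 8), Thm. 2.2 (p. 5), Thm. 3.2 and (3.4)/(3.6)
(p. 7), §3 (p. 5), proof of Thm. 7.4 (p. 13); [Kato2004Asterisque] Thm. 12.5;
[MazurTateTeitelbaum1986Invent] §I.8 (8.6); [PollackRubin2004] p. 448; [Lei2011] §1, §7.
-/

noncomputable section

open scoped Classical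

open CongruenceSubgroup Polynomial WeierstrassCurve Field Literature.NumberTheory.EllipticCurves
  Literature.NumberTheory.EllipticCurves.ModularForms Literature.NumberTheory.GaloisRepresentations
  ZpExtension

namespace Literature.NumberTheory.EllipticCurves.Kobayashi2003

/-- **Kobayashi 2003, Thm. 4.1, FIRST display** (p. 8: "There exists an integer `n ≥ 0` such that
`Char(X⁺(E/K_∞)^η) ⊇ (pⁿ L_p⁺(E, η, X))` […] If the `p`-adic representation `Gal(ℚ̄/ℚ) → GL_{ℤ_p}(T)`
is surjective, then we can take `n = 0`"), at THE quadratic character `η = ω^{(p−1)/2}` of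
`Δ = Gal(ℚ(μ_p)/ℚ)` — the unique non-trivial `{±1}`-valued character of `Γ_ℚ` trivial on `galRange K₀`
(the display is printed "for every `η`"; TODO(general form): `η` of any order `∣ p − 1`): frame of
`thm22_etaSignedSelmerDual_finite_torsion` plus `η ≠ 1`, the newform `f` of `V`, the period ratio `ϖ`
of the parity of `η`, `Lη` ANY function with the interpolation property (3.4) + (3.6) of `L_p⁺(V, η, X)`
(`IsQuadraticBranchPlusLFunction`; unique up to `ℤ_p^×`, flag `Kob03-Lpm-eta-upto-unit`), `γ` matching
the cyclotomic variable (`IsCyclotomicVariable`, "`γ ↦ 1 + X`", §3 p. 5), `D` any Pontryagin-dual datum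
of `Sel⁺(V/K_∞)^η` (`EtaSignedSelmerDualData … η γ 1`) taken finitely generated and torsion (displayed
hypotheses = `thm22_…`, as the siblings `thm41_signedCharIdeal_divisibility` (`η = 1`) and
`thm41_minusEtaCharIdeal_dvd` (sign `−`) display them): BOTH printed clauses — `∃ n, pⁿ·Lη ∈ Char(D.X)`,
and `Lη ∈ Char(D.X)` if `ρ_{V,p^∞}` is onto (`∀ m, V.HasSurjectiveModNGaloisRep (p^m)`). The Kato side
of the even main [C] at `η`; the converse inclusion is NOT asserted. Named fact; nothing asserted; no
`_holds`.
[cite: Kobayashi2003, Thm. 4.1 (p. 8), §4 Even main [C] (p. 8), Thm. 2.2 (p. 5), (3.4) and (3.6) (p. 7), §3 (p. 5); corpus `paper:doi-10-1007-s00222-002-0265-4` p0008]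
[cite: Kato2004Asterisque, Thm. 12.5 (the Euler-system input)] -/
def thm41_plusEtaCharIdeal_dvd : Prop :=
  ∀ (p : ℕ) [Fact p.Prime] (K₀ : Type) [Field K₀] [NumberField K₀] [IsCyclotomicExtension {p} ℚ K₀]
    [(galRange (K := ℚ) K₀).Normal] (η : absoluteGaloisGroup ℚ →* ℤˣ),
    (∀ σ ∈ galRange (K := ℚ) K₀, η σ = 1) → η ≠ 1 →
  ∀ (V : WeierstrassCurve ℚ) [V.IsElliptic] [V.IsGloballyMinimal] {N : ℕ} [NeZero N]
    {f : CuspForm (Gamma0 N) 2},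
    p ≠ 2 → V.HasGoodReductionAtPrime p → V.frobeniusTrace p = 0 → IsNewformOf V f →
  ∀ (ϖ : ℚ), (if Even (p / 2) then (ϖ : ℝ) * V.realPeriodRat = plusPeriod f
      else (ϖ : ℝ) * V.imaginaryPeriodRat = minusPeriod f) →
  ∀ (Lη : IwasawaAlgebra p), IsQuadraticBranchPlusLFunction f p ϖ Lη →
  ∀ (κ : ZpExtension ℚ p) (γ : absoluteGaloisGroup ℚ),
    κ.IsCyclotomic → κ.IsTopGenerator γ → γ ∈ galRange (K := ℚ) K₀ → IsCyclotomicVariable p γ →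
  ∀ (D : EtaSignedSelmerDualData V κ K₀ ℚ_[p] η γ 1),
    Module.Finite (IwasawaAlgebra p) D.X → Module.IsTorsion (IwasawaAlgebra p) D.X →
    (∃ n : ℕ, (p : IwasawaAlgebra p) ^ n * Lη ∈ D.charIdeal) ∧
    ((∀ m : ℕ, V.HasSurjectiveModNGaloisRep (p ^ m : ℕ)) → Lη ∈ D.charIdeal)

end Literature.NumberTheory.EllipticCurves.Kobayashi2003

end
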